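import Summits.AtomisticToContinuum.Crystallization.Theorems.OverbindingBudgetAffineLayerPoisson

/-!
# Overbinding budget, affine far-core cell (31280 Z2): the COSET-FREE MAIN TERM of a far-layer sum —
# absolute Poisson–Bessel expansion `Σ_{y∈L}(‖y−x‖²+c)^{−σ} = √πⁿΓ(μ)/(Γ(σ)·covol·c^μ) + 2√πⁿ/(Γ(σ)covol)·Σ_{w∈L*}cos(2π⟪x,w⟫)(π‖w‖/√c)^μ K_μ(2π√c‖w‖)`
# (decomp-a2c lens-4, generation 66, Deliverable F part 1 of 2 = memo NODE-g66 §8 item (T2); imports ONLY the landed `…LayerPoisson`)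

The landed Poisson–Bessel leaf `…LayerPoisson` proves the DIFFERENCE identity `F(0) − F(x) = …(1 − cos)…` (registry
insensitivity = coset SPREAD).  The window TABLE of Z2 (memo NODE-g65 §8 (V), NODE-g66 §8) needs the VALUE of every far
layer sum, not only its spread: this file proves the ABSOLUTE identity (same Gamma subordination + theta transformation
+ Tonelli + Mellin–Bessel chain, with the `w = 0` dual term producing the MAIN TERM `√πⁿ Γ(σ−n/2)/(Γ(σ) covol c^{σ−n/2})`
= `covol⁻¹ ∫_V (‖y‖²+c)^{−σ} dy`) and its consequences down to the two-generator layer form used by the window files.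
PROVED, 0 sorry, standard axioms (certified inlined in probe `TowerG66F.lean`, rc 0):

* §F1 `thetaShift_eq` (absolute theta transformation `Θ_L(u;x) = covol⁻¹(√(π/u))ⁿ Σ_{w∈L*} e^{−π²‖w‖²/u} cos 2π⟪x,w⟫`,
  from Literature `tsum_gaussianFunction_sub_eq`), `integral_rpow_mul_exp_neg_mul_eq` (`∫₀^∞ u^{μ−1}e^{−cu} = Γ(μ)/c^μ`),
  ★★ `tsum_inv_pow_shift_eq` (the absolute expansion above, `2σ > n`, `c > 0`), ★ `abs_tsum_inv_pow_shift_sub_main_le`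
  (`|F(x) − main| ≤ (2√πⁿ/(Γ(σ)covol)) Σ_{w∈L*} (π‖w‖/√c)^μ K_μ(2π√c‖w‖)` — HALF the two-coset spread constant of
  `tsum_inv_pow_shift_spread_le`, and coset-free);
* §F2 `abs_tsum_inv_pow_translate_sub_main_le` (ambient form: a full lattice `Λ` of a subspace `W ⊂ E`, translate `p ∉ W`,
  `c = dist(p,W)²`), `planar_main_term_eq` (`√π²Γ(σ−1)/(Γ(σ)(d²)^{σ−1}) = π/((σ−1)d^{2σ−2})`),
  ★ `abs_tsum_int_pair_translate_sub_main_le` (two-generator form: `|Σ_{(i,j)∈ℤ²} ‖iu+jv+p‖^{−2σ} − π/((σ−1)·covol·d^{2σ−2})|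
  ≤ (2π/(Γ(σ)covol)) Σ_{w∈Λ*} (π‖w‖/d)^{σ−1}K_{σ−1}(2πd‖w‖)`, `σ ≥ 2`).

Part 2 (`…LayerMain`) instantiates this in the window vocabulary (`layerSum B (2σ) k o`) and certifies two-sided
enclosures from the g66 dual Bessel kernel rows.
-/

noncomputable section
open MeasureTheory Set Module
open scoped Real InnerProductSpace

namespace Summit.AtomisticToContinuum.Crystallization.Theorems.OverbindingBudgetAffineFarSmoothSplit

open Literature.Algebra.EuclideanLattices Literature.Analysis.FunctionSpaces

section Abstract

variable {V : Type*} [NormedAddCommGroup V] [InnerProductSpace ℝ V] [FiniteDimensional ℝ V]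
  [MeasurableSpace V] [BorelSpace V]
variable (L : Submodule ℤ V) [DiscreteTopology L] [IsZLattice ℝ L]

/-! ## §F1 The absolute Poisson–Bessel expansion: main term + dual Bessel series -/

/-- **Poisson at one Gaussian scale, absolute form**:
`Θ_L(u;x) = covol⁻¹ (√(π/u))ⁿ Σ_{w ∈ L*} e^{−π²‖w‖²/u} cos 2π⟪x,w⟫` (`u > 0`). [folklore] -/
theorem thetaShift_eq {u : ℝ} (hu : 0 < u) (x : V) :
    thetaShift L u x =
      (ZLattice.covolume L)⁻¹ * Real.sqrt (π / u) ^ finrank ℝ V *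
        ∑' w : dualLattice L, Real.exp (-(π ^ 2 * ‖(w : V)‖ ^ 2 / u)) *
          Real.cos (2 * π * ⟪x, (w : V)⟫_ℝ) := by
  have hs : 0 < Real.sqrt (π / u) := Real.sqrt_pos.2 (div_pos Real.pi_pos hu)
  have hx : thetaShift L u x = ∑' y : L, gaussianFunction (Real.sqrt (π / u)) ((y : V) - x) := by
    unfold thetaShift
    refine tsum_congr fun y => ?_
    rw [gaussianFunction_sqrt_pi_div hu]
  rw [hx, tsum_gaussianFunction_sub_eq L hs x]
  congr 1
  refine tsum_congr fun w => ?_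
  rw [gaussianFunction_inv_sqrt_pi_div hu]

/-- The main-term Mellin integral `∫₀^∞ u^{μ−1} e^{−cu} du = Γ(μ)/c^μ` (`μ, c > 0`), with integrability. [folklore] -/
theorem integral_rpow_mul_exp_neg_mul_eq {μ c : ℝ} (hμ : 0 < μ) (hc : 0 < c) :
    (∫ u in Ioi (0 : ℝ), u ^ (μ - 1) * Real.exp (-(c * u))) = Real.Gamma μ / c ^ μ ∧
      IntegrableOn (fun u : ℝ => u ^ (μ - 1) * Real.exp (-(c * u))) (Ioi 0) := by
  have hval : (∫ u in Ioi (0 : ℝ), u ^ (μ - 1) * Real.exp (-(c * u))) = Real.Gamma μ / c ^ μ := by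
    rw [Real.integral_rpow_mul_exp_neg_mul_Ioi hμ hc, one_div, Real.inv_rpow hc.le]
    ring
  refine ⟨hval, ?_⟩
  refine Integrable.of_integral_ne_zero ?_
  rw [hval]
  exact (div_pos (Real.Gamma_pos_of_pos hμ) (Real.rpow_pos_of_pos hc μ)).ne'

/-- **The Poisson–Bessel expansion of a shifted Epstein-type sum, absolute form** (incomplete-Bessel /
Chowla–Selberg type): for `2σ > n = dim V`, `c > 0`, `x ∈ V`, `μ = σ − n/2`,
`Σ_{y∈L} (‖y−x‖²+c)^{−σ} = (√πⁿ/(Γ(σ) covol L)) · (Γ(μ)/c^μ + 2 Σ_{w∈L*} cos(2π⟪x,w⟫) (π‖w‖/√c)^μ K_μ(2π√c‖w‖))`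
(the `w = 0` Bessel term vanishes since `0^μ = 0`; the first summand is the MAIN TERM — the integral of the
summand over `V` divided by the covolume). [folklore] -/
theorem tsum_inv_pow_shift_eq (σ : ℕ) (hσ : finrank ℝ V < 2 * σ) {c : ℝ} (hc : 0 < c) (x : V) :
    ∑' y : L, ((‖(y : V) - x‖ ^ 2 + c) ^ σ)⁻¹ =
      Real.sqrt π ^ finrank ℝ V / (Real.Gamma σ * ZLattice.covolume L) *
        (Real.Gamma ((σ : ℝ) - finrank ℝ V / 2) / c ^ ((σ : ℝ) - finrank ℝ V / 2) +
          2 * ∑' w : dualLattice L, Real.cos (2 * π * ⟪x, (w : V)⟫_ℝ) *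
            ((π * ‖(w : V)‖ / Real.sqrt c) ^ ((σ : ℝ) - finrank ℝ V / 2) *
              besselKReal ((σ : ℝ) - finrank ℝ V / 2) (2 * π * Real.sqrt c * ‖(w : V)‖))) := by
  classical
  -- abbreviations
  set n : ℕ := finrank ℝ V with hn
  set μ : ℝ := (σ : ℝ) - (n : ℝ) / 2 with hμ
  set C₀ : ℝ := (ZLattice.covolume L)⁻¹ * Real.sqrt π ^ n with hC₀
  have hσ0 : 0 < σ := by omega
  have hσ' : (0 : ℝ) < σ := by exact_mod_cast hσ0
  have hG : 0 < Real.Gamma σ := Real.Gamma_pos_of_pos hσ'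
  have hcov : 0 < ZLattice.covolume L := ZLattice.covolume_pos L volume
  have hC₀pos : 0 < C₀ := by positivity
  have hμpos : 0 < μ := by
    simp only [hμ]
    have : (n : ℝ) < 2 * σ := by exact_mod_cast hσ
    linarith
  -- the Bessel summand `T w`, the phases `b w = cos 2π⟪x,w⟫`
  set T : dualLattice L → ℝ := fun w =>
    (π * ‖(w : V)‖ / Real.sqrt c) ^ μ * besselKReal μ (2 * π * Real.sqrt c * ‖(w : V)‖) with hT
  have hK : Summable T := summable_rpow_mul_besselKReal (dualLattice L) hμpos hc
  set b : dualLattice L → ℝ := fun w => Real.cos (2 * π * ⟪x, (w : V)⟫_ℝ) with hb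
  have hb1 : ∀ w, |b w| ≤ 1 := fun w => Real.abs_cos_le_one _
  have hb0 : b 0 = 1 := by simp [hb]
  have hT0 : ∀ w, 0 ≤ T w := by
    intro w
    by_cases hw : (w : V) = 0
    · simp [hT, hw, Real.zero_rpow hμpos.ne']
    · exact mul_nonneg (Real.rpow_nonneg (by positivity) _)
        (besselKReal_pos μ (by positivity [norm_pos_iff.2 hw])).le
  have hTz : T 0 = 0 := by simp [hT, Real.zero_rpow hμpos.ne']
  -- the main integral and the per-`w` integrals `J w`
  set I₀ : ℝ := Real.Gamma μ / c ^ μ with hI₀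
  have hI₀pos : 0 < I₀ := div_pos (Real.Gamma_pos_of_pos hμpos) (Real.rpow_pos_of_pos hc μ)
  set J : dualLattice L → ℝ := fun w => if w = 0 then I₀ else 2 * T w with hJ
  have hJ' : ∀ w, J w = 2 * T w + if w = 0 then I₀ else 0 := by
    intro w
    by_cases hw : w = 0
    · simp [hJ, hw, hTz]
    · simp [hJ, hw]
  have hJ0 : ∀ w, 0 ≤ J w := fun w => by
    rw [hJ' w]
    have := hT0 w
    split_ifs <;> linarith [hI₀pos.le]
  have hJsum : Summable J := by
    have h : Summable fun w : dualLattice L => 2 * T w + if w = 0 then I₀ else 0 :=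
      (hK.mul_left 2).add (hasSum_ite_eq (0 : dualLattice L) I₀).summable
    exact h.congr fun w => (hJ' w).symm
  -- the dual core family and its integrals
  set core : dualLattice L → ℝ → ℝ := fun w u =>
    u ^ (μ - 1) * Real.exp (-(c * u + π ^ 2 * ‖(w : V)‖ ^ 2 / u)) with hcore
  have hcoreJ : ∀ w, (∫ u in Ioi (0 : ℝ), core w u) = J w ∧ IntegrableOn (core w) (Ioi 0) := by
    intro w
    by_cases hw : w = 0
    · have hw' : (w : V) = 0 := by rw [hw]; rfl
      have hc' : core w = fun u => u ^ (μ - 1) * Real.exp (-(c * u)) := by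
        funext u; simp [hcore, hw']
      rw [hc', show J w = I₀ by simp [hJ, hw]]
      exact integral_rpow_mul_exp_neg_mul_eq hμpos hc
    · have hw' : (w : V) ≠ 0 := fun h => hw (Subtype.ext h)
      obtain ⟨hval, hint⟩ := integral_core_eq_besselKReal hc μ hw'
      refine ⟨?_, hint⟩
      simp only [hcore] at hval ⊢
      rw [hval]
      simp [hJ, hw, hT, mul_assoc]
  set q : dualLattice L → ℝ → ℝ := fun w u => C₀ * b w * core w u with hq
  have hcore_nn : ∀ w, ∀ u ∈ Ioi (0 : ℝ), 0 ≤ core w u := fun w u hu => by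
    have hu : 0 < u := hu
    simp only [hcore]; positivity
  have hq_int : ∀ w, Integrable (q w) (volume.restrict (Ioi (0 : ℝ))) := fun w =>
    ((hcoreJ w).2.integrable.const_mul (C₀ * b w)).congr (Filter.Eventually.of_forall fun u => rfl)
  have hq_val : ∀ w, (∫ u in Ioi (0 : ℝ), q w u) = C₀ * (b w * J w) := fun w => by
    simp only [hq]
    rw [integral_const_mul, (hcoreJ w).1]
    ring
  have hq_norm : ∀ w, (∫ u in Ioi (0 : ℝ), ‖q w u‖) = C₀ * (|b w| * J w) := fun w => by
    have h1 : (∫ u in Ioi (0 : ℝ), ‖q w u‖) = ∫ u in Ioi (0 : ℝ), C₀ * |b w| * core w u := by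
      refine setIntegral_congr_fun measurableSet_Ioi fun u hu => ?_
      simp only [hq]
      rw [Real.norm_eq_abs, abs_mul, abs_mul, abs_of_pos hC₀pos, abs_of_nonneg (hcore_nn w u hu)]
    rw [h1, integral_const_mul, (hcoreJ w).1]
    ring
  have hq_sum : Summable fun w => ∫ u in Ioi (0 : ℝ), ‖q w u‖ := by
    simp_rw [hq_norm]
    refine ((hJsum.mul_left C₀).of_nonneg_of_le (fun w => ?_) fun w => ?_)
    · exact mul_nonneg hC₀pos.le (mul_nonneg (abs_nonneg _) (hJ0 w))
    · exact mul_le_mul_of_nonneg_left (by nlinarith [hb1 w, hJ0 w, abs_nonneg (b w)]) hC₀pos.le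
  -- the subordinated integral
  set B : ℝ → ℝ := fun u => u ^ ((σ : ℝ) - 1) * (Real.exp (-(c * u)) * thetaShift L u x) with hB
  have hFx : ∑' y : L, ((‖(y : V) - x‖ ^ 2 + c) ^ σ)⁻¹ = (Real.Gamma σ)⁻¹ * ∫ u in Ioi (0 : ℝ), B u :=
    tsum_inv_pow_eq_integral_thetaShift L σ hσ hc x
  -- pointwise on `u > 0`: B u = Σ_w q w u
  have hpt : ∀ u ∈ Ioi (0 : ℝ), B u = ∑' w, q w u := by
    intro u hu
    have hu : 0 < u := hu
    have hpow : u ^ ((σ : ℝ) - 1) * u ^ (-((n : ℝ) / 2)) = u ^ (μ - 1) := by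
      rw [← Real.rpow_add hu]
      congr 1
      simp only [hμ]
      ring
    simp only [hB]
    rw [thetaShift_eq L hu x, sqrt_pi_div_pow hu n]
    simp only [← tsum_mul_left]
    refine tsum_congr fun w => ?_
    have hexp : Real.exp (-(c * u + π ^ 2 * ‖(w : V)‖ ^ 2 / u)) =
        Real.exp (-(c * u)) * Real.exp (-(π ^ 2 * ‖(w : V)‖ ^ 2 / u)) := by
      rw [neg_add, Real.exp_add]
    simp only [hq, hcore, hb, hC₀, hexp, ← hpow]
    ring
  -- the integral of B
  have hIB : (∫ u in Ioi (0 : ℝ), B u) = C₀ * (I₀ + 2 * ∑' w, b w * T w) := by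
    rw [setIntegral_congr_fun measurableSet_Ioi (fun u hu => hpt u hu),
      ← integral_tsum_of_summable_integral_norm hq_int hq_sum]
    simp_rw [hq_val]
    rw [tsum_mul_left]
    congr 1
    have hbT : Summable fun w => b w * T w := by
      refine Summable.of_norm_bounded hK fun w => ?_
      rw [Real.norm_eq_abs, abs_mul, abs_of_nonneg (hT0 w)]
      exact mul_le_of_le_one_left (hT0 w) (hb1 w)
    have hsplit : ∀ w, b w * J w = 2 * (b w * T w) + if w = 0 then I₀ else 0 := by
      intro w
      rw [hJ' w]
      by_cases hw : w = 0
      · simp [hw, hb0]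
      · simp [hw]; ring
    simp_rw [hsplit]
    rw [(hbT.mul_left 2).tsum_add (hasSum_ite_eq (0 : dualLattice L) I₀).summable, tsum_mul_left,
      (hasSum_ite_eq (0 : dualLattice L) I₀).tsum_eq]
    ring
  rw [hFx, hIB]
  have hS : (∑' w, b w * T w) = ∑' w : dualLattice L, Real.cos (2 * π * ⟪x, (w : V)⟫_ℝ) *
      ((π * ‖(w : V)‖ / Real.sqrt c) ^ μ * besselKReal μ (2 * π * Real.sqrt c * ‖(w : V)‖)) := rfl
  rw [← hS]
  generalize (∑' w, b w * T w) = S₀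
  rw [hC₀, hI₀]
  field_simp

/-- **The main term with an exponentially small remainder**: for `2σ > n`, `c > 0`, `x ∈ V`, `μ = σ − n/2`,
`|Σ_{y∈L} (‖y−x‖²+c)^{−σ} − √πⁿ Γ(μ)/(Γ(σ) covol L · c^μ)| ≤ (2√πⁿ/(Γ(σ) covol L)) Σ_{w∈L*} (π‖w‖/√c)^μ K_μ(2π√c‖w‖)`
— HALF the two-coset spread constant of `tsum_inv_pow_shift_spread_le`, and COSET-FREE. [folklore] -/
theorem abs_tsum_inv_pow_shift_sub_main_le (σ : ℕ) (hσ : finrank ℝ V < 2 * σ) {c : ℝ} (hc : 0 < c)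
    (x : V) :
    |(∑' y : L, ((‖(y : V) - x‖ ^ 2 + c) ^ σ)⁻¹) -
        Real.sqrt π ^ finrank ℝ V / (Real.Gamma σ * ZLattice.covolume L) *
          (Real.Gamma ((σ : ℝ) - finrank ℝ V / 2) / c ^ ((σ : ℝ) - finrank ℝ V / 2))| ≤
      2 * Real.sqrt π ^ finrank ℝ V / (Real.Gamma σ * ZLattice.covolume L) *
        ∑' w : dualLattice L,
          (π * ‖(w : V)‖ / Real.sqrt c) ^ ((σ : ℝ) - finrank ℝ V / 2) *
            besselKReal ((σ : ℝ) - finrank ℝ V / 2) (2 * π * Real.sqrt c * ‖(w : V)‖) := by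
  classical
  rw [tsum_inv_pow_shift_eq L σ hσ hc x]
  have hμ : 0 < (σ : ℝ) - finrank ℝ V / 2 := by
    have : (finrank ℝ V : ℝ) < 2 * σ := by exact_mod_cast hσ
    linarith
  have hK := summable_rpow_mul_besselKReal (dualLattice L) hμ hc
  have hσ0 : 0 < σ := by omega
  have hG : 0 < Real.Gamma σ := Real.Gamma_pos_of_pos (by exact_mod_cast hσ0)
  have hcov : 0 < ZLattice.covolume L := ZLattice.covolume_pos L volume
  have hK0 : 0 ≤ Real.sqrt π ^ finrank ℝ V / (Real.Gamma σ * ZLattice.covolume L) := by positivity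
  have hT0 : ∀ w : dualLattice L, 0 ≤ (π * ‖(w : V)‖ / Real.sqrt c) ^ ((σ : ℝ) - finrank ℝ V / 2) *
      besselKReal ((σ : ℝ) - finrank ℝ V / 2) (2 * π * Real.sqrt c * ‖(w : V)‖) :=
    fun w => besselTerm_nonneg hμ hc (w : V)
  set T : dualLattice L → ℝ := fun w => (π * ‖(w : V)‖ / Real.sqrt c) ^ ((σ : ℝ) - finrank ℝ V / 2) *
      besselKReal ((σ : ℝ) - finrank ℝ V / 2) (2 * π * Real.sqrt c * ‖(w : V)‖) with hT
  set S := ∑' w : dualLattice L, Real.cos (2 * π * ⟪x, (w : V)⟫_ℝ) * T w with hS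
  have hST : |S| ≤ ∑' w, T w := by
    have hn : Summable fun w : dualLattice L => ‖Real.cos (2 * π * ⟪x, (w : V)⟫_ℝ) * T w‖ := by
      refine Summable.of_nonneg_of_le (fun w => norm_nonneg _) (fun w => ?_) hK
      rw [Real.norm_eq_abs, abs_mul, abs_of_nonneg (hT0 w)]
      exact mul_le_of_le_one_left (hT0 w) (Real.abs_cos_le_one _)
    refine (Real.norm_eq_abs S ▸ norm_tsum_le_tsum_norm hn).trans ?_
    refine hn.tsum_le_tsum (fun w => ?_) hK
    rw [Real.norm_eq_abs, abs_mul, abs_of_nonneg (hT0 w)]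
    exact mul_le_of_le_one_left (hT0 w) (Real.abs_cos_le_one _)
  have hrew : Real.sqrt π ^ finrank ℝ V / (Real.Gamma σ * ZLattice.covolume L) *
        (Real.Gamma ((σ : ℝ) - finrank ℝ V / 2) / c ^ ((σ : ℝ) - finrank ℝ V / 2) + 2 * S) -
      Real.sqrt π ^ finrank ℝ V / (Real.Gamma σ * ZLattice.covolume L) *
        (Real.Gamma ((σ : ℝ) - finrank ℝ V / 2) / c ^ ((σ : ℝ) - finrank ℝ V / 2)) =
      2 * Real.sqrt π ^ finrank ℝ V / (Real.Gamma σ * ZLattice.covolume L) * S := by ring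
  have h2 : (0 : ℝ) ≤ 2 * Real.sqrt π ^ finrank ℝ V / (Real.Gamma σ * ZLattice.covolume L) := by
    positivity
  rw [hrew, abs_mul, abs_of_nonneg h2]
  exact mul_le_mul_of_nonneg_left hST h2

end Abstract

/-! ## §F2 Layers in an ambient space: the main term of a translated planar-lattice sum -/

section Ambient

variable {E : Type*} [NormedAddCommGroup E] [InnerProductSpace ℝ E] [FiniteDimensional ℝ E]

/-- **Main term of a layer sum, ambient form**: `W ⊂ E` a subspace, `Λ ⊂ W` a full lattice, `p ∉ W`,
`d = dist(p, W)`, `μ = σ − dim W/2 > 0`; then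
`|Σ_{y∈Λ} ‖y + p‖^{−2σ} − √π^{dim W} Γ(μ)/(Γ(σ) covol Λ · d^{2μ})| ≤ (2√π^{dim W}/(Γ(σ) covol Λ)) Σ_{w∈Λ*} (π‖w‖/d)^μ K_μ(2πd‖w‖)`
(Pythagoras `‖y + p‖² = ‖y + Pp‖² + d²` reduces to §F1 inside `W`). [this file] -/
theorem abs_tsum_inv_pow_translate_sub_main_le (W : Submodule ℝ E) [MeasurableSpace W] [BorelSpace W]
    (Λ : Submodule ℤ W) [DiscreteTopology Λ] [IsZLattice ℝ Λ]
    (σ : ℕ) (hσ : finrank ℝ W < 2 * σ) {p : E} (hp : p ∉ W) :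
    |(∑' y : Λ, ((‖((y : W) : E) + p‖ ^ 2) ^ σ)⁻¹) -
        Real.sqrt π ^ finrank ℝ W / (Real.Gamma σ * ZLattice.covolume Λ) *
          (Real.Gamma ((σ : ℝ) - finrank ℝ W / 2) /
            (‖p - W.starProjection p‖ ^ 2) ^ ((σ : ℝ) - finrank ℝ W / 2))| ≤
      2 * Real.sqrt π ^ finrank ℝ W / (Real.Gamma σ * ZLattice.covolume Λ) *
        ∑' w : dualLattice Λ,
          (π * ‖(w : W)‖ / ‖p - W.starProjection p‖) ^ ((σ : ℝ) - finrank ℝ W / 2) *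
            besselKReal ((σ : ℝ) - finrank ℝ W / 2)
              (2 * π * ‖p - W.starProjection p‖ * ‖(w : W)‖) := by
  set d : ℝ := ‖p - W.starProjection p‖ with hd
  have hd0 : 0 < d := by
    refine norm_pos_iff.2 (sub_ne_zero.2 fun h => hp ?_)
    rw [h]; exact W.starProjection_apply_mem p
  have hc : 0 < d ^ 2 := by positivity
  set x : W := ⟨W.starProjection p, W.starProjection_apply_mem p⟩ with hx
  have hF : ∀ y : Λ, ((‖((y : W) : E) + p‖ ^ 2) ^ σ)⁻¹ = ((‖(y : W) - (-x)‖ ^ 2 + d ^ 2) ^ σ)⁻¹ := by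
    intro y
    rw [norm_sq_coe_add_eq W (y : W) p, sub_neg_eq_add]
  simp_rw [hF]
  have h := abs_tsum_inv_pow_shift_sub_main_le Λ σ hσ hc (-x)
  rwa [Real.sqrt_sq hd0.le] at h

/-- Arithmetic of the planar main term: `√π² Γ(σ−1)/(Γ(σ) (d²)^{σ−1}) = π/((σ−1) d^{2σ−2})` (`σ ≥ 2`, `d > 0`). [folklore] -/
theorem planar_main_term_eq {σ : ℕ} (hσ : 1 < σ) {A d : ℝ} (hA : 0 < A) (hd : 0 < d) :
    Real.sqrt π ^ 2 / (Real.Gamma σ * A) * (Real.Gamma ((σ : ℝ) - 1) / (d ^ 2) ^ ((σ : ℝ) - 1)) =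
      π / (((σ : ℝ) - 1) * A * d ^ (2 * σ - 2)) := by
  have hs1 : (0 : ℝ) < (σ : ℝ) - 1 := by
    have : (1 : ℝ) < σ := by exact_mod_cast hσ
    linarith
  have hΓ : Real.Gamma (σ : ℝ) = ((σ : ℝ) - 1) * Real.Gamma ((σ : ℝ) - 1) := by
    rw [show (σ : ℝ) = ((σ : ℝ) - 1) + 1 by ring, Real.Gamma_add_one hs1.ne']
    ring_nf
  have hΓ1 : 0 < Real.Gamma ((σ : ℝ) - 1) := Real.Gamma_pos_of_pos hs1
  have hpow : (d ^ 2) ^ ((σ : ℝ) - 1) = d ^ (2 * σ - 2) := by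
    rw [show (σ : ℝ) - 1 = ((σ - 1 : ℕ) : ℝ) by rw [Nat.cast_sub hσ.le]; push_cast; ring,
      Real.rpow_natCast, ← pow_mul]
    congr 1
    omega
  rw [hpow, hΓ, Real.sq_sqrt Real.pi_pos.le]
  have hdp : 0 < d ^ (2 * σ - 2) := pow_pos hd _
  field_simp

/-- **Main term of a two-generator layer sum** (the form instantiated by the far-core window
certificates with `u = B t₁`, `v = B t₂`, `p = layerShift B o k`): for independent `u, v`, `p ∉ span{u,v}`,
`σ ≥ 2`, `d = dist(p, span{u,v})`, `Λ = ℤu + ℤv`,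
`|Σ_{(i,j)} ‖iu + jv + p‖^{−2σ} − π/((σ−1)·covol Λ·d^{2σ−2})| ≤ (2π/(Γ(σ)·covol Λ)) Σ_{w∈Λ*} (π‖w‖/d)^{σ−1} K_{σ−1}(2πd‖w‖)`.
The main term `π/((σ−1) covol d^{2σ−2}) = covol⁻¹ ∫_{ℝ²} (|y|²+d²)^{−σ} dy` is COSET-INDEPENDENT. [this file] -/
theorem abs_tsum_int_pair_translate_sub_main_le {u v : E} (huv : LinearIndependent ℝ ![u, v])
    [MeasurableSpace (Submodule.span ℝ (Set.range ![u, v]))]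
    [BorelSpace (Submodule.span ℝ (Set.range ![u, v]))]
    (σ : ℕ) (hσ : 1 < σ) {p : E} (hp : p ∉ Submodule.span ℝ (Set.range ![u, v])) :
    |(∑' ij : ℤ × ℤ, ((‖(ij.1 : ℝ) • u + (ij.2 : ℝ) • v + p‖ ^ 2) ^ σ)⁻¹) -
        π / (((σ : ℝ) - 1) *
          ZLattice.covolume (Submodule.span ℤ (Set.range (Basis.span huv))) *
            ‖p - (Submodule.span ℝ (Set.range ![u, v])).starProjection p‖ ^ (2 * σ - 2))| ≤
      2 * π / (Real.Gamma σ * ZLattice.covolume (Submodule.span ℤ (Set.range (Basis.span huv)))) *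
        ∑' w : dualLattice (Submodule.span ℤ (Set.range (Basis.span huv))),
          (π * ‖(w : Submodule.span ℝ (Set.range ![u, v]))‖ /
              ‖p - (Submodule.span ℝ (Set.range ![u, v])).starProjection p‖) ^ ((σ : ℝ) - 1) *
            besselKReal ((σ : ℝ) - 1)
              (2 * π * ‖p - (Submodule.span ℝ (Set.range ![u, v])).starProjection p‖ *
                ‖(w : Submodule.span ℝ (Set.range ![u, v]))‖) := by
  rw [tsum_int_pair_eq_tsum_span huv (fun z => ((‖z + p‖ ^ 2) ^ σ)⁻¹)]
  have hrank : finrank ℝ (Submodule.span ℝ (Set.range ![u, v])) = 2 := finrank_span_pair huv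
  have hσ' : finrank ℝ (Submodule.span ℝ (Set.range ![u, v])) < 2 * σ := by rw [hrank]; omega
  have h := abs_tsum_inv_pow_translate_sub_main_le (Submodule.span ℝ (Set.range ![u, v]))
    (Submodule.span ℤ (Set.range (Basis.span huv))) σ hσ' hp
  have hμ : ((σ : ℝ) - (finrank ℝ (Submodule.span ℝ (Set.range ![u, v])) : ℝ) / 2) = (σ : ℝ) - 1 := by
    rw [hrank]; norm_num
  rw [hμ, hrank] at h
  have hd0 : 0 < ‖p - (Submodule.span ℝ (Set.range ![u, v])).starProjection p‖ := by
    refine norm_pos_iff.2 (sub_ne_zero.2 fun h' => hp ?_)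
    rw [h']; exact Submodule.starProjection_apply_mem _ p
  have hcov : 0 < ZLattice.covolume (Submodule.span ℤ (Set.range (Basis.span huv))) :=
    ZLattice.covolume_pos _ volume
  rw [planar_main_term_eq hσ hcov hd0, Real.sq_sqrt Real.pi_pos.le] at h
  exact h

end Ambient

end Summit.AtomisticToContinuum.Crystallization.Theorems.OverbindingBudgetAffineFarSmoothSplit

end
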